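import Mathlib
import Literature.AlgebraicGeometry.Resolution.CobordantGame
import Literature.AlgebraicGeometry.Resolution.CobordantChartCoefficients
import Literature.AlgebraicGeometry.Resolution.FormalCoordinateChange
import Summits.ResolutionOfSingularities.ResolutionOfSingularities.Theorems.WeightedInvariantLocalWeightedDropWildMonicWideExit

/-!
# `WeightedInvariant.LocalWeightedDrop`, line `hasse-ridge-face-selection`: the ORDER-`d` EXIT of the monomial terminal class —
# a successor whose scaled vertex has `|v| = 1` is of order `d` and NOT WIDE when the vertex is not solvable

Crux item stmt-ResolutionOfSingularities-8899 `LocalWeightedDrop` (route `ResolutionOfSingularities/WeightedInvariant`), engine of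
the door `HypersurfaceCentreConstruction` stmt-ResolutionOfSingularities-19897.  [OURS · L1 W4.3, chain w43, res-type-083 (extra
seat S3ρ, CHAIN v4.3 D12): §1 (T) of `L/res-type-083/S3RHO-DESIGN.md`, exit (E2) of the monomial class TermMono.  Not a statement
of any manuscript; the mathematics is Hironaka's «solvable vertex» test for `y^d + Σ A_j y^j` read through the Taylor shift.]

`not_wide_of_vertex_one`: let the tuple `A` have all scaled support `≥ (a, b)` (scale `N = a + b`: every monomial `x^β` of `A_j`
has `N β ≥ (d-j)(a,b)`), a non-zero coefficient AT the scaled vertex, and — when the vertex is integral, i.e. `(a,b) ∈ {(N,0),(0,N)}`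
— a vertex polynomial `Y^d + Σ_j τ_j Y^j` different from every `(Y - μ)^d`.  Then the degree-`d` form of `y^d + Σ A_j y^j` does NOT
have two independent translation-invariance vectors.  Proof: if it had, `WildMonic.exists_linShift_isPos_of_wide` re-centres
linearly (`φ = -Σ μ_i x_i`) to a position `B`; undoing the shift (`shift_shift_neg`) shows that the degree-`(d-j)` part of `A_j` is
`C(d,j) · (Σ μ_i x_i)^{d-j}` (`coeff_eq_choose_mul_coeff_linPow`); reading this at `x₀^{d-j}` / `x₁^{d-j}` (`coeff_single_linPow_*`)
forces `μ = 0` off the axes (contradicting the vertex coefficient) and a solvable vertex on them.  Also: `le_order_monicForm_of_support`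
(order `≥ d` from the support condition).
-/

set_option linter.dupNamespace false -- mandated namespace of this single-conjunct summit

namespace Summit.ResolutionOfSingularities.ResolutionOfSingularities.Theorems

open Literature.AlgebraicGeometry.Resolution
open Literature.AlgebraicGeometry.Resolution.CobordantGame

namespace WildMonic

open MvPowerSeries

variable {k : Type} [Field k] {m : ℕ}

/-! ### Order from the support -/

/-- If every monomial `x'^β` of `A_j` has `|β| ≥ d - j`, the monic form has order `≥ d`. -/
theorem le_order_monicForm_of_support {d : ℕ} (A : Fin d → MvPowerSeries (Fin m) k)
    (h : ∀ (j : Fin d) (β : Fin m →₀ ℕ), coeff β (A j) ≠ 0 → d - (j : ℕ) ≤ β.degree) :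
    (d : ℕ∞) ≤ (X (Fin.last m) ^ d + ∑ j : Fin d, rename (Fin.succAboveEmb (Fin.last m)) (A j) * X (Fin.last m) ^ (j : ℕ)).order := by
  classical
  refine nat_le_order fun E hE => ?_
  obtain ⟨β, hEeq⟩ := TschirnhausForm.exists_eq_emb_add_single E
  set n := E (Fin.last m) with hn
  have hdeg : E.degree = β.degree + n := by rw [hEeq, TschirnhausForm.degree_emb_add_single]
  rw [hEeq, WeierstrassForm.coeff_monicForm, if_neg (by omega), zero_add]
  refine Finset.sum_eq_zero fun j _ => ?_
  split_ifs with hj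
  · by_contra hne
    have := h j β hne
    omega
  · rfl

/-- The «tail» `Σ_j B_j y^j` of the monic form of a POSITION has order `≥ d + 1`. -/
theorem succ_le_order_tail_of_isPos {d : ℕ} (B : Fin d → MvPowerSeries (Fin m) k)
    (hB : ∀ j : Fin d, ((d - (j : ℕ) : ℕ) : ℕ∞) < (B j).order) :
    ((d + 1 : ℕ) : ℕ∞) ≤ (∑ j : Fin d, rename (Fin.succAboveEmb (Fin.last m)) (B j) * X (Fin.last m) ^ (j : ℕ)).order := by
  classical
  refine nat_le_order fun E hE => ?_
  obtain ⟨β, hEeq⟩ := TschirnhausForm.exists_eq_emb_add_single E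
  set n := E (Fin.last m) with hn
  have hdeg : E.degree = β.degree + n := by rw [hEeq, TschirnhausForm.degree_emb_add_single]
  rw [hEeq, map_sum]
  refine Finset.sum_eq_zero fun j _ => ?_
  rw [TschirnhausForm.coeff_emb_add_single_mul_X_pow]
  split_ifs with hle
  · rw [TschirnhausForm.coeff_emb_add_single_rename]
    split_ifs with h0
    · have hjn : (j : ℕ) = n := by omega
      apply coeff_of_lt_order
      refine lt_of_le_of_lt ?_ (hB j)
      exact_mod_cast (by omega : β.degree ≤ d - (j : ℕ))
    · rfl
  · rfl

/-! ### Undoing a shift -/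

/-- Shifting by `φ` and then by `-φ` returns the tuple. -/
theorem shift_shift_neg {R : Type*} [CommRing R] [Nontrivial R] (d : ℕ) (A : Fin d → R) (φ : R) :
    shift d (shift d A φ) (-φ) = A := by
  funext j
  rw [shift, ← taylor_monicPoly, Polynomial.taylor_taylor, neg_add_cancel, Polynomial.taylor_zero, coeff_monicPoly_of_lt]

/-! ### Coefficients of powers of a linear form in two variables -/

/-- `[x₀^n] (μ₀ x₀ + μ₁ x₁)^n = μ₀^n`. -/
theorem coeff_single_zero_linPow (μ : Fin 2 → k) (n : ℕ) :
    coeff (Finsupp.single 0 n) ((∑ i : Fin 2, C (μ i) * X i : MvPowerSeries (Fin 2) k) ^ n) = μ 0 ^ n := by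
  classical
  rw [Fin.sum_univ_two, add_pow, map_sum, Finset.sum_eq_single n]
  · rw [Nat.sub_self, pow_zero, mul_one, Nat.choose_self, Nat.cast_one, mul_one, mul_pow, ← map_pow, coeff_C_mul,
      coeff_X_pow, if_pos rfl, mul_one]
  · intro i hi hne
    have hlt : i < n := lt_of_le_of_ne (Nat.lt_succ_iff.mp (Finset.mem_range.mp hi)) hne
    rw [mul_pow, mul_pow, ← map_pow, ← map_pow, show C (μ 0 ^ i) * (X 0 : MvPowerSeries (Fin 2) k) ^ i *
        (C (μ 1 ^ (n - i)) * X 1 ^ (n - i)) * ((n.choose i : ℕ) : MvPowerSeries (Fin 2) k) =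
        C (μ 0 ^ i * μ 1 ^ (n - i) * (n.choose i : k)) * (X 0 ^ i * X 1 ^ (n - i)) by
          rw [map_mul, map_mul, map_natCast]; ring]
    rw [coeff_C_mul, X_pow_eq, X_pow_eq, monomial_mul_monomial, one_mul, coeff_monomial, if_neg, mul_zero]
    intro h
    have h1 := DFunLike.congr_fun h 1
    simp at h1
    omega
  · intro h
    exact absurd (Finset.mem_range.mpr (Nat.lt_succ_self n)) h

/-- `[x₁^n] (μ₀ x₀ + μ₁ x₁)^n = μ₁^n`. -/
theorem coeff_single_one_linPow (μ : Fin 2 → k) (n : ℕ) :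
    coeff (Finsupp.single 1 n) ((∑ i : Fin 2, C (μ i) * X i : MvPowerSeries (Fin 2) k) ^ n) = μ 1 ^ n := by
  classical
  rw [Fin.sum_univ_two, add_pow, map_sum, Finset.sum_eq_single 0]
  · rw [pow_zero, one_mul, Nat.sub_zero, Nat.choose_zero_right, Nat.cast_one, mul_one, mul_pow, ← map_pow, coeff_C_mul,
      coeff_X_pow, if_pos rfl, mul_one]
  · intro i hi hne
    have hpos : 0 < i := Nat.pos_of_ne_zero hne
    rw [mul_pow, mul_pow, ← map_pow, ← map_pow, show C (μ 0 ^ i) * (X 0 : MvPowerSeries (Fin 2) k) ^ i *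
        (C (μ 1 ^ (n - i)) * X 1 ^ (n - i)) * ((n.choose i : ℕ) : MvPowerSeries (Fin 2) k) =
        C (μ 0 ^ i * μ 1 ^ (n - i) * (n.choose i : k)) * (X 0 ^ i * X 1 ^ (n - i)) by
          rw [map_mul, map_mul, map_natCast]; ring]
    rw [coeff_C_mul, X_pow_eq, X_pow_eq, monomial_mul_monomial, one_mul, coeff_monomial, if_neg, mul_zero]
    intro h
    have h0 := DFunLike.congr_fun h 0
    simp at h0
    omega
  · intro h
    exact absurd (Finset.mem_range.mpr (Nat.succ_pos n)) h

/-- Renamed plane series have no monomial involving `y`. -/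
theorem noY_rename (g : MvPowerSeries (Fin m) k) : ∀ E : Fin (m + 1) →₀ ℕ, E (Fin.last m) ≠ 0 →
    coeff E (rename (Fin.succAboveEmb (Fin.last m)) g) = 0 := by
  intro E hE
  obtain ⟨β, hEeq⟩ := TschirnhausForm.exists_eq_emb_add_single E
  rw [hEeq, TschirnhausForm.coeff_emb_add_single_rename, if_neg hE]

/-- A `Fin 2`-exponent has degree `β 0 + β 1`. -/
theorem degree_fin_two (β : Fin 2 →₀ ℕ) : β.degree = β 0 + β 1 := by
  simp [Finsupp.degree_eq_sum, Fin.sum_univ_two]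

/-! ### The degree-`(d-j)` part of `A_j` after undoing a linear re-centring to a position -/

/-- If the linear re-centring `y ↦ y - ψ`, `ψ = Σ μ_i x_i`, carries the tuple `A` to a POSITION `B = shift d A (-ψ)`, then in
degree `d - j` the coefficient `A_j` coincides with `C(d,j) · ψ^{d-j}`: `[x^β] A_j = C(d,j) · [x^β] ψ^{d-j}` for `|β| = d - j`. -/
theorem coeff_eq_choose_mul_coeff_linPow {d : ℕ} (A : Fin d → MvPowerSeries (Fin m) k) (μ : Fin m → k)
    (hB : ∀ j : Fin d, ((d - (j : ℕ) : ℕ) : ℕ∞) < (shift d A (-(∑ i : Fin m, C (μ i) * X i)) j).order)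
    (j : Fin d) (β : Fin m →₀ ℕ) (hβ : β.degree = d - (j : ℕ)) :
    coeff β (A j) = (d.choose (j : ℕ) : k) * coeff β ((∑ i : Fin m, C (μ i) * X i : MvPowerSeries (Fin m) k) ^ (d - (j : ℕ))) := by
  classical
  set ψ : MvPowerSeries (Fin m) k := ∑ i : Fin m, C (μ i) * X i with hψ
  set B : Fin d → MvPowerSeries (Fin m) k := shift d A (-ψ) with hBdef
  have hψ0 : constantCoeff ψ = 0 := by
    rw [hψ, map_sum, Finset.sum_eq_zero]
    intro i _; rw [map_mul, constantCoeff_X, mul_zero]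
  -- undo the shift: `A = shift d B ψ`, so the monic form of `A` is the shear image of the monic form of `B`
  have hA : shift d B ψ = A := by
    rw [hBdef]
    conv_rhs => rw [← shift_shift_neg d A (-ψ)]
    rw [neg_neg]
  have hform := subst_shear_monicForm (m := m) ψ hψ0 B
  rw [hA] at hform
  -- the monic form of `B` is `y^d` plus a tail of order `≥ d + 1`
  set tail : MvPowerSeries (Fin (m + 1)) k :=
    ∑ l : Fin d, rename (Fin.succAboveEmb (Fin.last m)) (B l) * X (Fin.last m) ^ (l : ℕ) with htail
  have htail_ord := succ_le_order_tail_of_isPos B hB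
  have h0 : ∀ l, constantCoeff ((fun l : Fin (m + 1) => if l = Fin.last m
      then X (Fin.last m) + rename (Fin.succAboveEmb (Fin.last m)) ψ else X l) l) = 0 := by
    intro l
    dsimp only
    split_ifs
    · rw [map_add, constantCoeff_X, constantCoeff_rename, hψ0, add_zero]
    · exact constantCoeff_X l
  have hs := hasSubst_of_constantCoeff_zero h0
  -- read the coefficient of `x^β y^j` on both sides
  have hlhs := WeierstrassForm.coeff_monicForm_of_lt A β j
  rw [← hform, ← coe_substAlgHom hs, map_add, map_pow, coe_substAlgHom, subst_X hs] at hlhs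
  rw [if_pos rfl, map_add] at hlhs
  -- the tail contributes nothing in degree `d`
  have htail0 : coeff (Finsupp.embDomain (Fin.succAboveEmb (Fin.last m)) β + Finsupp.single (Fin.last m) (j : ℕ))
      (subst (fun l : Fin (m + 1) => if l = Fin.last m then X (Fin.last m) + rename (Fin.succAboveEmb (Fin.last m)) ψ else X l)
        tail) = 0 := by
    apply coeff_of_lt_order
    refine lt_of_lt_of_le ?_ (ConeDichotomy.le_order_subst_of_le _ h0 tail _ htail_ord)
    rw [TschirnhausForm.degree_emb_add_single, hβ]
    have := j.2
    exact_mod_cast (by omega : d - (j : ℕ) + (j : ℕ) < d + 1)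
  have hβE : (Finsupp.embDomain (Fin.succAboveEmb (Fin.last m)) β) (Fin.last m) = 0 := TschirnhausForm.embDomain_last β
  rw [htail0, add_zero, ← one_mul ((X (Fin.last m) + rename (Fin.succAboveEmb (Fin.last m)) ψ) ^ d),
    TschirnhausForm.coeff_add_single_mul_add_pow TschirnhausForm.noY_one (noY_rename ψ) hβE, one_mul, ← map_pow,
    coeff_embDomain_rename] at hlhs
  exact hlhs.symm

/-! ### The order-`d` exit of the monomial class -/

/-- THE ORDER-`d` EXIT OF THE MONOMIAL TERMINAL CLASS: if every monomial `x^β` of `A_j` has `N β ≥ (d-j)(a,b)` componentwise with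
`a + b = N`, some coefficient sits AT the scaled vertex, and the vertex polynomial is not `(Y - μ)^d` whenever the vertex is integral,
then the degree-`d` form of `y^d + Σ A_j y^j` does NOT have two independent translation-invariance vectors. -/
theorem not_wide_of_vertex_one (k : Type) [Field k] [IsAlgClosed k] {d : ℕ} (hd : 0 < d) (N a b : ℕ) (hN : 0 < N)
    (hab : a + b = N) (A : Fin d → MvPowerSeries (Fin 2) k)
    (hM1 : ∀ (j : Fin d) (β : Fin 2 →₀ ℕ), coeff β (A j) ≠ 0 → (d - (j : ℕ)) * a ≤ N * β 0 ∧ (d - (j : ℕ)) * b ≤ N * β 1)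
    (hM2 : ∃ (j₀ : Fin d) (β : Fin 2 →₀ ℕ), N * β 0 = (d - (j₀ : ℕ)) * a ∧ N * β 1 = (d - (j₀ : ℕ)) * b ∧ coeff β (A j₀) ≠ 0)
    (hM3 : N ∣ a → N ∣ b → ∀ μ : k, ∃ j : Fin d,
      coeff (Finsupp.single 0 ((d - (j : ℕ)) * a / N) + Finsupp.single 1 ((d - (j : ℕ)) * b / N)) (A j) ≠
        (d.choose (j : ℕ) : k) * (-μ) ^ (d - (j : ℕ))) :
    ¬ ∃ c₁ c₂ : Fin 3 → k, (∀ α β : k, α • c₁ + β • c₂ = 0 → α = 0 ∧ β = 0) ∧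
      (∀ v : Fin 3 → k, CobordantChart.initEval (fun _ : Fin 3 => 1) (v + c₁) d
        ((X (Fin.last 2) : MvPowerSeries (Fin (2 + 1)) k) ^ d +
          ∑ j : Fin d, rename (Fin.succAboveEmb (Fin.last 2)) (A j) * X (Fin.last 2) ^ (j : ℕ)) =
        CobordantChart.initEval (fun _ : Fin 3 => 1) v d
        ((X (Fin.last 2) : MvPowerSeries (Fin (2 + 1)) k) ^ d +
          ∑ j : Fin d, rename (Fin.succAboveEmb (Fin.last 2)) (A j) * X (Fin.last 2) ^ (j : ℕ))) ∧
      (∀ v : Fin 3 → k, CobordantChart.initEval (fun _ : Fin 3 => 1) (v + c₂) d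
        ((X (Fin.last 2) : MvPowerSeries (Fin (2 + 1)) k) ^ d +
          ∑ j : Fin d, rename (Fin.succAboveEmb (Fin.last 2)) (A j) * X (Fin.last 2) ^ (j : ℕ)) =
        CobordantChart.initEval (fun _ : Fin 3 => 1) v d
        ((X (Fin.last 2) : MvPowerSeries (Fin (2 + 1)) k) ^ d +
          ∑ j : Fin d, rename (Fin.succAboveEmb (Fin.last 2)) (A j) * X (Fin.last 2) ^ (j : ℕ))) := by
  classical
  rintro ⟨c₁, c₂, hind, h₁, h₂⟩
  -- order `≥ d` from the support condition
  have hsupp : ∀ (j : Fin d) (β : Fin 2 →₀ ℕ), coeff β (A j) ≠ 0 → d - (j : ℕ) ≤ β.degree := by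
    intro j β hβ
    obtain ⟨h0, h1⟩ := hM1 j β hβ
    rw [degree_fin_two]
    have h : N * (d - (j : ℕ)) ≤ N * (β 0 + β 1) := by
      have := Nat.add_le_add h0 h1
      rw [← Nat.mul_add, hab, Nat.mul_comm] at this
      rw [Nat.mul_add]; exact this
    exact Nat.le_of_mul_le_mul_left h hN
  have hSo := le_order_monicForm_of_support A hsupp
  -- a wide apex re-centres linearly to a position; read the degree-`(d-j)` parts of the `A_j`
  obtain ⟨μ, hpos⟩ := exists_linShift_isPos_of_wide k hd A hSo c₁ c₂ hind h₁ h₂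
  have key := fun (j : Fin d) (β : Fin 2 →₀ ℕ) (hβ : β.degree = d - (j : ℕ)) =>
    coeff_eq_choose_mul_coeff_linPow A μ hpos j β hβ
  obtain ⟨j₀, β₀, h0a, h0b, hne⟩ := hM2
  rcases Nat.eq_zero_or_pos b with hb0 | hbpos
  · -- `b = 0`, `a = N`: the vertex `(1, 0)` would be solvable
    have haN : a = N := by omega
    obtain ⟨j, hj⟩ := hM3 ⟨1, by rw [haN, mul_one]⟩ ⟨0, by rw [hb0, mul_zero]⟩ (-(μ 0))
    apply hj
    rw [haN, hb0, mul_zero, Nat.zero_div, Finsupp.single_zero, add_zero, Nat.mul_div_cancel _ hN, neg_neg,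
      key j (Finsupp.single 0 (d - (j : ℕ))) (by rw [Finsupp.degree_single]), coeff_single_zero_linPow]
  rcases Nat.eq_zero_or_pos a with ha0 | hapos
  · -- `a = 0`, `b = N`: the vertex `(0, 1)` would be solvable
    have hbN : b = N := by omega
    obtain ⟨j, hj⟩ := hM3 ⟨0, by rw [ha0, mul_zero]⟩ ⟨1, by rw [hbN, mul_one]⟩ (-(μ 1))
    apply hj
    rw [ha0, hbN, mul_zero, Nat.zero_div, Finsupp.single_zero, zero_add, Nat.mul_div_cancel _ hN, neg_neg,
      key j (Finsupp.single 1 (d - (j : ℕ))) (by rw [Finsupp.degree_single]), coeff_single_one_linPow]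
  -- `a, b > 0`: the pure monomials `x₀^{d}`, `x₁^{d}` of `A_0` are absent, so `μ = 0` — but then the vertex coefficient vanishes
  have hμ : ∀ i : Fin 2, μ i = 0 := by
    intro i
    by_contra hμi
    have hkey := key ⟨0, hd⟩ (Finsupp.single i d) (by rw [Finsupp.degree_single, Nat.sub_zero])
    have hval : coeff (Finsupp.single i d) ((∑ l : Fin 2, C (μ l) * X l : MvPowerSeries (Fin 2) k) ^ (d - 0)) = μ i ^ d := by
      rw [Nat.sub_zero]
      have hi : i = 0 ∨ i = 1 := by fin_cases i <;> simp
      rcases hi with rfl | rfl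
      · exact coeff_single_zero_linPow μ d
      · exact coeff_single_one_linPow μ d
    rw [hval, Nat.choose_zero_right, Nat.cast_one, one_mul] at hkey
    have hc : coeff (Finsupp.single i d) (A ⟨0, hd⟩) ≠ 0 := by rw [hkey]; exact pow_ne_zero _ hμi
    obtain ⟨h0', h1'⟩ := hM1 ⟨0, hd⟩ _ hc
    simp only [Nat.sub_zero] at h0' h1'
    have hi : i = 0 ∨ i = 1 := by fin_cases i <;> simp
    rcases hi with rfl | rfl
    · rw [Finsupp.single_eq_of_ne (show (1 : Fin 2) ≠ 0 by decide)] at h1'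
      simp only [mul_zero, nonpos_iff_eq_zero, mul_eq_zero] at h1'
      omega
    · rw [Finsupp.single_eq_of_ne (show (0 : Fin 2) ≠ 1 by decide)] at h0'
      simp only [mul_zero, nonpos_iff_eq_zero, mul_eq_zero] at h0'
      omega
  have hψ : (∑ l : Fin 2, C (μ l) * X l : MvPowerSeries (Fin 2) k) = 0 := by
    rw [Fin.sum_univ_two, hμ 0, hμ 1, map_zero, zero_mul, zero_mul, add_zero]
  have hdeg : β₀.degree = d - (j₀ : ℕ) := by
    rw [degree_fin_two]
    have h : N * (β₀ 0 + β₀ 1) = N * (d - (j₀ : ℕ)) := by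
      rw [Nat.mul_add, h0a, h0b, ← Nat.mul_add, hab, Nat.mul_comm]
    exact Nat.eq_of_mul_eq_mul_left hN h
  have h := key j₀ β₀ hdeg
  rw [hψ, zero_pow (Nat.sub_ne_zero_of_lt j₀.2), map_zero, mul_zero] at h
  exact hne h

end WildMonic

end Summit.ResolutionOfSingularities.ResolutionOfSingularities.Theorems
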